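import Mathlib
import Literature.MathematicalPhysics.QuantumLattice.BallSpecification
import Summits.CriticalPhenomena.Ising3DConformalLimit.Theorems.MarkovRigidityFieldRealisationClusterLimit
import HarnessLib

/-!
# `BallSpecification.BallSpecifiedFieldLimit` — stub `stub_splitAtSpheres` (item stmt-CriticalPhenomena-11247), proved

THEOREM-ONLY file. Registered stub `stub_splitAtSpheres` (B1) of the line `registered`
(`Cruxes/BallSpecifiedFieldLimit/Lines/birth.lean`): Ising-free measure theory on `𝓢'(ℝ³)`.

**Statement.** Let `μ` be a probability law on `FieldConfig ℝ³ = 𝓢'(ℝ³)` all of whose evaluations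
`ω ↦ ω f` are square integrable and whose two-point function has a DENSITY `S₂` on `(ℝ³)²`,
`E_μ[ω(f) ω(g)] = ∫ S₂(x) f(x₀) g(x₁) dx`, with `|S₂(x)| ≤ C · max(1, ‖x₀ − x₁‖^{-a})` off the diagonal,
`0 < a < 3`. Then for every sphere `∂B(c, s)` (`s > 0`), every open `U` and every test function `f`
supported in `U`, the evaluation `ω ↦ ω f` is `μ`-a.e. equal to a function measurable for the join
`extEvents (U ∩ ball c s) ⊔ extEvents (U ∩ (closedBall c s)ᶜ)`: test functions SPLIT AT EVERY SPHERE
modulo `μ`-null sets.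

**Proof** (`L²` cutoff argument; the sphere is Lebesgue-null).
* `SplitAtSpheres.exists_cutoff_split`: with smooth bumps `χₙⁱⁿ` (`= 1` on `B̄(c, s − 2εₙ)`, supported in
  `B̄(c, s − εₙ) ⊆ B(c, s)`) and `χₙ'` (`= 1` on `B̄(c, s + εₙ)`, supported in `B̄(c, s + 2εₙ)`),
  `εₙ = (s/3)/(n+1)`, put `fₙⁱⁿ = χₙⁱⁿ f`, `fₙᵒᵘᵗ = (1 − χₙ') f`, `gₙ = (χₙ' − χₙⁱⁿ) f`; then
  `f = fₙⁱⁿ + fₙᵒᵘᵗ + gₙ`, `|gₙ| ≤ |f|`, and `gₙ(x) = 0` eventually for every `x ∉ ∂B(c, s)`.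
* `SplitAtSpheres.tendsto_integral_twoPoint_cutoff`: `∫ S₂ (gₙ ⊗ gₙ) → 0` by dominated convergence on
  `(ℝ³)²` (dominator `C max(1, ‖x₀−x₁‖^{-a}) K² (1+‖x₀‖)^{-4} (1+‖x₁‖)^{-4}`, integrable for `a < 3`
  by `MarkovRigidityFieldRealisation.integrable_weight_shift_kernel`; pointwise the integrand vanishes
  eventually off the null set `{x₀ ∈ ∂B}`).
* `SplitAtSpheres.exists_measurable_ae_eq_of_tendsto_integral_sq`: if `E_μ[(F − ψₙ)²] → 0` with `ψₙ`
  measurable for a sub-σ-algebra `m`, then `F` is a.e. equal to the `m`-measurable `limsup` of an a.e.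
  convergent subsequence (`tendstoInMeasure_of_tendsto_eLpNorm`, `TendstoInMeasure.exists_seq_tendsto_ae`).
* `stub_splitAtSpheres`: `E_μ[(ω f − ω fₙⁱⁿ − ω fₙᵒᵘᵗ)²] = E_μ[ω(gₙ)²] = ∫ S₂ (gₙ ⊗ gₙ) → 0`.

References: Yu. A. Rozanov, *Markov Random Fields* (1982), Ch. 2 §1.3 (additivity of the local
σ-algebras of a generalised random function); folklore. No definitions are introduced.
-/

noncomputable section

namespace Summit.CriticalPhenomena.Ising3DConformalLimit.Theorems

open MeasureTheory Filter Metric Set Literature.MathematicalPhysics.QuantumLattice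
open scoped SchwartzMap ENNReal Topology

namespace SplitAtSpheres

/-! ### Smooth cutoffs at a sphere -/

/-- **Smooth splitting of a test function at a sphere, up to a thin collar.** For `s > 0`, a test
function `f` supported in `U` and every `n`, there are test functions `fₙⁱⁿ` (supported in
`U ∩ B(c, s)`), `fₙᵒᵘᵗ` (supported in `U ∩ B̄(c, s)ᶜ`) and a remainder `gₙ` with
`fₙⁱⁿ + fₙᵒᵘᵗ + gₙ = f`, `|gₙ| ≤ |f|` pointwise, and `gₙ(x) = 0` eventually for every `x` off the
sphere `∂B(c, s)` (smooth bumps `χ f`, `(1 − χ') f`, `(χ' − χ) f`). [folklore] -/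
theorem exists_cutoff_split {E : Type*} [NormedAddCommGroup E] [NormedSpace ℝ E]
    [FiniteDimensional ℝ E] (c : E) {s : ℝ} (hs : 0 < s) (U : Set E) (f : 𝓢(E, ℝ))
    (hfU : tsupport (f : E → ℝ) ⊆ U) :
    ∃ fin fout g : ℕ → 𝓢(E, ℝ),
      (∀ n, tsupport (fin n : E → ℝ) ⊆ U ∩ ball c s) ∧
      (∀ n, tsupport (fout n : E → ℝ) ⊆ U ∩ (closedBall c s)ᶜ) ∧
      (∀ n, fin n + fout n + g n = f) ∧
      (∀ n x, |g n x| ≤ |f x|) ∧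
      (∀ x, dist x c ≠ s → ∀ᶠ n in atTop, g n x = 0) := by
  -- the collar widths `εₙ → 0`, `0 < εₙ ≤ s / 3`
  obtain ⟨ε, hε⟩ : ∃ ε : ℕ → ℝ, ε = fun n : ℕ => s / 3 * (1 / ((n : ℝ) + 1)) := ⟨_, rfl⟩
  have hε0 : ∀ n, 0 < ε n := fun n => by rw [hε]; positivity
  have hεle : ∀ n, ε n ≤ s / 3 := fun n => by
    rw [hε]
    have h1 : 1 / ((n : ℝ) + 1) ≤ 1 := by
      rw [div_le_one (by positivity)]
      linarith [(Nat.cast_nonneg n : (0 : ℝ) ≤ n)]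
    calc s / 3 * (1 / ((n : ℝ) + 1)) ≤ s / 3 * 1 := by gcongr
      _ = s / 3 := mul_one _
  have hεt : Tendsto ε atTop (𝓝 0) := by
    have h := tendsto_one_div_add_atTop_nhds_zero_nat.const_mul (s / 3)
    rw [mul_zero] at h
    rw [hε]
    exact h
  -- the bumps
  obtain ⟨χi, hχi_in, hχi_out⟩ : ∃ χ : ℕ → ContDiffBump c,
      (∀ n, (χ n).rIn = s - 2 * ε n) ∧ (∀ n, (χ n).rOut = s - ε n) :=
    ⟨fun n => ⟨s - 2 * ε n, s - ε n, by linarith [hεle n], by linarith [hε0 n]⟩,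
      fun _ => rfl, fun _ => rfl⟩
  obtain ⟨χo, hχo_in, hχo_out⟩ : ∃ χ : ℕ → ContDiffBump c,
      (∀ n, (χ n).rIn = s + ε n) ∧ (∀ n, (χ n).rOut = s + 2 * ε n) :=
    ⟨fun n => ⟨s + ε n, s + 2 * ε n, by linarith [hε0 n], by linarith [hε0 n]⟩,
      fun _ => rfl, fun _ => rfl⟩
  have hχig : ∀ n, Function.HasTemperateGrowth (χi n : E → ℝ) := fun n =>
    (χi n).hasCompactSupport.hasTemperateGrowth (χi n).contDiff
  have hχog : ∀ n, Function.HasTemperateGrowth (χo n : E → ℝ) := fun n =>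
    (χo n).hasCompactSupport.hasTemperateGrowth (χo n).contDiff
  have h1og : ∀ n, Function.HasTemperateGrowth (fun x : E => 1 - χo n x) := fun n =>
    (Function.HasTemperateGrowth.const 1).sub (hχog n)
  have hoig : ∀ n, Function.HasTemperateGrowth (fun x : E => χo n x - χi n x) := fun n =>
    (hχog n).sub (hχig n)
  refine ⟨fun n => SchwartzMap.smulLeftCLM ℝ (χi n : E → ℝ) f,
    fun n => SchwartzMap.smulLeftCLM ℝ (fun x : E => 1 - χo n x) f,
    fun n => SchwartzMap.smulLeftCLM ℝ (fun x : E => χo n x - χi n x) f,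
    fun n => ?_, fun n => ?_, fun n => ?_, fun n x => ?_, fun x hx => ?_⟩
  · -- support of the inner piece
    intro x hx
    have hx' := SchwartzMap.tsupport_smulLeftCLM_subset (χi n : E → ℝ) f hx
    refine ⟨hfU hx'.1, ?_⟩
    have hxχ : x ∈ closedBall c (χi n).rOut := (χi n).tsupport_eq ▸ hx'.2
    rw [mem_closedBall, hχi_out] at hxχ
    rw [mem_ball]
    linarith [hε0 n]
  · -- support of the outer piece
    intro x hx
    have hx' := SchwartzMap.tsupport_smulLeftCLM_subset (fun x : E => 1 - χo n x) f hx
    refine ⟨hfU hx'.1, ?_⟩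
    have hsub : tsupport (fun x : E => 1 - χo n x) ⊆ (ball c (χo n).rIn)ᶜ := by
      refine closure_minimal (fun y hy hyb => ?_) isOpen_ball.isClosed_compl
      exact hy (show 1 - χo n y = 0 by
        rw [(χo n).one_of_mem_closedBall (ball_subset_closedBall hyb), sub_self])
    have hx'' := hsub hx'.2
    rw [mem_compl_iff, mem_ball, not_lt, hχo_in] at hx''
    rw [mem_compl_iff, mem_closedBall, not_le]
    linarith [hε0 n]
  · -- the three pieces sum to `f`
    ext x
    rw [add_apply, add_apply, SchwartzMap.smulLeftCLM_apply_apply (hχig n),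
      SchwartzMap.smulLeftCLM_apply_apply (h1og n), SchwartzMap.smulLeftCLM_apply_apply (hoig n),
      smul_eq_mul, smul_eq_mul, smul_eq_mul]
    ring
  · -- the remainder is dominated by `f`
    rw [SchwartzMap.smulLeftCLM_apply_apply (hoig n), smul_eq_mul, abs_mul]
    refine mul_le_of_le_one_left (abs_nonneg _) (abs_sub_le_iff.2 ⟨?_, ?_⟩)
    · linarith [((χo n).le_one : χo n x ≤ 1), ((χi n).nonneg : 0 ≤ χi n x)]
    · linarith [((χi n).le_one : χi n x ≤ 1), ((χo n).nonneg : 0 ≤ χo n x)]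
  · -- the remainder vanishes eventually off the sphere
    rcases lt_or_gt_of_ne hx with hlt | hgt
    · have hpos : 0 < (s - dist x c) / 2 := by linarith
      filter_upwards [hεt.eventually (gt_mem_nhds hpos)] with n hn
      rw [SchwartzMap.smulLeftCLM_apply_apply (hoig n), smul_eq_mul]
      have h1 : χo n x = 1 := (χo n).one_of_mem_closedBall (by
        rw [mem_closedBall, hχo_in]; linarith [hε0 n])
      have h2 : χi n x = 1 := (χi n).one_of_mem_closedBall (by
        rw [mem_closedBall, hχi_in]; linarith)
      rw [h1, h2, sub_self, zero_mul]
    · have hpos : 0 < (dist x c - s) / 2 := by linarith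
      filter_upwards [hεt.eventually (gt_mem_nhds hpos)] with n hn
      rw [SchwartzMap.smulLeftCLM_apply_apply (hoig n), smul_eq_mul]
      have h1 : χo n x = 0 := (χo n).zero_of_le_dist (by rw [hχo_out]; linarith)
      have h2 : χi n x = 0 := (χi n).zero_of_le_dist (by rw [hχi_out]; linarith [hε0 n])
      rw [h1, h2, sub_self, zero_mul]

/-! ### The collar two-point integrals tend to zero -/

/-- **Dominated convergence for the collar remainders.** If `S₂` is measurable on `(ℝ³)²` with
`|S₂(x)| ≤ C max(1, ‖x₀ − x₁‖^{-a})` off the diagonal (`0 < a < 3`), `|gₙ| ≤ |f|` for a Schwartz `f`,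
and `gₙ(p) = 0` eventually for a.e. `p ∈ ℝ³`, then `∫ S₂(x) gₙ(x₀) gₙ(x₁) dx → 0` (dominator
`C K² (1+‖x₀‖)^{-4} (1+‖x₁‖)^{-4} max(1, ‖x₁ − x₀‖^{-a})`, `K` the Schwartz decay constant of `f`).
[folklore] -/
theorem tendsto_integral_twoPoint_cutoff {S₂ : (Fin 2 → EuclideanSpace ℝ (Fin 3)) → ℝ} {C a : ℝ}
    (hS : Measurable S₂) (ha0 : 0 < a) (ha3 : a < 3)
    (hbd : ∀ x : Fin 2 → EuclideanSpace ℝ (Fin 3), x 0 ≠ x 1 →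
      |S₂ x| ≤ C * max 1 (‖x 0 - x 1‖ ^ (-a)))
    (f : 𝓢(EuclideanSpace ℝ (Fin 3), ℝ)) (g : ℕ → 𝓢(EuclideanSpace ℝ (Fin 3), ℝ))
    (hgf : ∀ n x, |g n x| ≤ |f x|)
    (hg0 : ∀ᵐ p : EuclideanSpace ℝ (Fin 3), ∀ᶠ n in atTop, g n p = 0) :
    Tendsto (fun n => ∫ x : Fin 2 → EuclideanSpace ℝ (Fin 3), S₂ x * (g n (x 0) * g n (x 1)))
      atTop (𝓝 0) := by
  -- Schwartz decay of `f`
  obtain ⟨K, hfK⟩ : ∃ K : ℝ, ∀ p : EuclideanSpace ℝ (Fin 3), |f p| ≤ K * (1 + ‖p‖) ^ (-(4 : ℝ)) :=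
    ⟨_, MarkovRigidityFieldRealisation.abs_le_seminorm_mul_weight f⟩
  -- the dominator
  obtain ⟨bound, hbound⟩ : ∃ bound : (Fin 2 → EuclideanSpace ℝ (Fin 3)) → ℝ, bound = fun x =>
      C * K * K * ((1 + ‖x 0‖) ^ (-(4 : ℝ)) * (1 + ‖x 1 - 0‖) ^ (-(4 : ℝ)) *
        max 1 (‖x 1 - x 0‖ ^ (-a))) := ⟨_, rfl⟩
  have hbi : Integrable bound := by
    rw [hbound]
    exact (MarkovRigidityFieldRealisation.integrable_weight_shift_kernel ha0.le ha3 0).const_mul _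
  have hmeas : ∀ n, AEStronglyMeasurable
      (fun x : Fin 2 → EuclideanSpace ℝ (Fin 3) => S₂ x * (g n (x 0) * g n (x 1))) volume :=
    fun n => (hS.mul ((((g n).continuous.measurable.comp (measurable_pi_apply 0))).mul
      ((g n).continuous.measurable.comp (measurable_pi_apply 1)))).aestronglyMeasurable
  have hdom : ∀ n, ∀ᵐ x : Fin 2 → EuclideanSpace ℝ (Fin 3),
      ‖S₂ x * (g n (x 0) * g n (x 1))‖ ≤ bound x := fun n => by
    filter_upwards [MarkovRigidityFieldRealisation.ae_mem_nonCoincident 2] with x hx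
    have hinj : Function.Injective x := hx
    have hne : x 0 ≠ x 1 := hinj.ne (by decide)
    have hS0 := hbd x hne
    have hg0' : |g n (x 0)| ≤ K * (1 + ‖x 0‖) ^ (-(4 : ℝ)) := (hgf n _).trans (hfK _)
    have hg1' : |g n (x 1)| ≤ K * (1 + ‖x 1‖) ^ (-(4 : ℝ)) := (hgf n _).trans (hfK _)
    rw [Real.norm_eq_abs, abs_mul, abs_mul]
    calc |S₂ x| * (|g n (x 0)| * |g n (x 1)|)
        ≤ (C * max 1 (‖x 0 - x 1‖ ^ (-a))) *
            ((K * (1 + ‖x 0‖) ^ (-(4 : ℝ))) * (K * (1 + ‖x 1‖) ^ (-(4 : ℝ)))) :=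
          mul_le_mul hS0 (mul_le_mul hg0' hg1' (abs_nonneg _) ((abs_nonneg _).trans hg0'))
            (mul_nonneg (abs_nonneg _) (abs_nonneg _)) ((abs_nonneg _).trans hS0)
      _ = bound x := by
          rw [hbound]
          simp only [sub_zero, norm_sub_rev (x 0) (x 1)]
          ring
  have hlim : ∀ᵐ x : Fin 2 → EuclideanSpace ℝ (Fin 3),
      Tendsto (fun n => S₂ x * (g n (x 0) * g n (x 1))) atTop (𝓝 0) := by
    have h0 : ∀ᵐ x : Fin 2 → EuclideanSpace ℝ (Fin 3), ∀ᶠ n in atTop, g n (x 0) = 0 :=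
      (Measure.tendsto_eval_ae_ae (μ := fun _ : Fin 2 => (volume : Measure (EuclideanSpace ℝ (Fin 3))))
        (i := 0)).eventually hg0
    filter_upwards [h0] with x hx
    refine tendsto_const_nhds.congr' ?_
    filter_upwards [hx] with n hn
    rw [hn, zero_mul, mul_zero]
  have h := tendsto_integral_of_dominated_convergence
    (F := fun n (x : Fin 2 → EuclideanSpace ℝ (Fin 3)) => S₂ x * (g n (x 0) * g n (x 1)))
    (f := fun _ => (0 : ℝ)) bound hmeas hbi hdom hlim
  rwa [integral_zero] at h

/-! ### From `L²` convergence to an a.e. equal measurable representative -/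

/-- **`L²`-limits of `m`-measurable functions have `m`-measurable versions.** If `ψₙ` are measurable
for a sub-σ-algebra `m`, `F − ψₙ ∈ L²(μ)` and `∫ (F − ψₙ)² dμ → 0`, then `F` is `μ`-a.e. equal to an
`m`-measurable function (the `limsup` of an a.e. convergent subsequence: convergence in `L²` implies
convergence in measure, `TendstoInMeasure.exists_seq_tendsto_ae`). [folklore] -/
theorem exists_measurable_ae_eq_of_tendsto_integral_sq {Ω : Type*} {m m0 : MeasurableSpace Ω}
    {μ : Measure Ω} (hm : m ≤ m0) {ψ : ℕ → Ω → ℝ} {F : Ω → ℝ}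
    (hψ : ∀ n, Measurable[m] (ψ n)) (hF : AEStronglyMeasurable F μ)
    (hL2 : ∀ n, MemLp (fun ω => F ω - ψ n ω) 2 μ)
    (hlim : Tendsto (fun n => ∫ ω, (F ω - ψ n ω) ^ 2 ∂μ) atTop (𝓝 0)) :
    ∃ φ : Ω → ℝ, Measurable[m] φ ∧ F =ᵐ[μ] φ := by
  have hψ' : ∀ n, AEStronglyMeasurable (ψ n) μ := fun n =>
    ((hψ n).mono hm le_rfl).aestronglyMeasurable
  have hnorm : ∀ n, eLpNorm (ψ n - F) 2 μ =
      ENNReal.ofReal (Real.sqrt (∫ ω, (F ω - ψ n ω) ^ 2 ∂μ)) := fun n => by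
    rw [eLpNorm_sub_comm]
    change eLpNorm (fun ω => F ω - ψ n ω) 2 μ = _
    rw [(hL2 n).eLpNorm_eq_integral_rpow_norm two_ne_zero ENNReal.ofNat_ne_top]
    simp only [ENNReal.toReal_ofNat, Real.rpow_two, sq_abs, Real.norm_eq_abs]
    rw [Real.sqrt_eq_rpow, show ((2 : ℝ))⁻¹ = 1 / 2 by norm_num]
  have htend : Tendsto (fun n => eLpNorm (ψ n - F) 2 μ) atTop (𝓝 0) := by
    have h1 : Tendsto (fun n => ENNReal.ofReal (Real.sqrt (∫ ω, (F ω - ψ n ω) ^ 2 ∂μ))) atTop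
        (𝓝 (ENNReal.ofReal (Real.sqrt 0))) :=
      ENNReal.tendsto_ofReal ((Real.continuous_sqrt.tendsto 0).comp hlim)
    rw [Real.sqrt_zero, ENNReal.ofReal_zero] at h1
    exact h1.congr' (Eventually.of_forall fun n => (hnorm n).symm)
  obtain ⟨ns, -, hae⟩ :=
    (tendstoInMeasure_of_tendsto_eLpNorm two_ne_zero hψ' hF htend).exists_seq_tendsto_ae
  refine ⟨fun ω => limsup (fun i => ψ (ns i) ω) atTop, Measurable.limsup fun i => hψ (ns i), ?_⟩
  filter_upwards [hae] with ω hω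
  exact hω.limsup_eq.symm

end SplitAtSpheres

/-- **Registered stub `stub_splitAtSpheres` (B1 · test functions split at every sphere modulo `μ`),
proved** (Ising-free measure theory): if every evaluation of the probability law `μ` on `𝓢'(ℝ³)` is
square integrable and the two-point function of `μ` has a density `S₂` on `(ℝ³)²` with
`|S₂(x₀,x₁)| ≤ C·max(1, ‖x₀−x₁‖^{-a})` off the diagonal, `0 < a < 3`, then for every sphere `∂B(c, s)`
(`s > 0`), every open `U` and every test function `f` supported in `U`, `ω ↦ ω f` is `μ`-a.e. equal to
a function measurable for `extEvents (U ∩ ball c s) ⊔ extEvents (U ∩ (closedBall c s)ᶜ)`.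
Proof: smooth cutoffs `f = fₙⁱⁿ + fₙᵒᵘᵗ + gₙ` (`SplitAtSpheres.exists_cutoff_split`),
`E_μ[ω(gₙ)²] = ∫ S₂ gₙ ⊗ gₙ → 0` by dominated convergence (the sphere is Lebesgue-null,
`SplitAtSpheres.tendsto_integral_twoPoint_cutoff`), and an a.e. convergent subsequence of the
join-measurable `ω(fₙⁱⁿ) + ω(fₙᵒᵘᵗ)` (`SplitAtSpheres.exists_measurable_ae_eq_of_tendsto_integral_sq`).
[folklore] -/
theorem stub_splitAtSpheres :
    ∀ (μ : MeasureTheory.Measure (Literature.MathematicalPhysics.QuantumLattice.FieldConfig (EuclideanSpace ℝ (Fin 3)))),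
      MeasureTheory.IsProbabilityMeasure μ →
      (∀ f : SchwartzMap (EuclideanSpace ℝ (Fin 3)) ℝ, MeasureTheory.MemLp (fun ω : Literature.MathematicalPhysics.QuantumLattice.FieldConfig (EuclideanSpace ℝ (Fin 3)) => ω f) 2 μ) →
      (∃ (S₂ : (Fin 2 → EuclideanSpace ℝ (Fin 3)) → ℝ) (C a : ℝ), Measurable S₂ ∧ 0 < a ∧ a < 3 ∧
        (∀ x : Fin 2 → EuclideanSpace ℝ (Fin 3), x 0 ≠ x 1 → |S₂ x| ≤ C * max 1 (‖x 0 - x 1‖ ^ (-a))) ∧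
        ∀ f g : SchwartzMap (EuclideanSpace ℝ (Fin 3)) ℝ,
          ∫ ω, ω f * ω g ∂μ = ∫ x : Fin 2 → EuclideanSpace ℝ (Fin 3), S₂ x * (f (x 0) * g (x 1))) →
      ∀ (c : EuclideanSpace ℝ (Fin 3)) (s : ℝ), 0 < s → ∀ (U : Set (EuclideanSpace ℝ (Fin 3))), IsOpen U →
        ∀ f : SchwartzMap (EuclideanSpace ℝ (Fin 3)) ℝ, tsupport (f : EuclideanSpace ℝ (Fin 3) → ℝ) ⊆ U →
          ∃ φ : Literature.MathematicalPhysics.QuantumLattice.FieldConfig (EuclideanSpace ℝ (Fin 3)) → ℝ,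
            Measurable[Literature.MathematicalPhysics.QuantumLattice.extEvents (U ∩ Metric.ball c s) ⊔
              Literature.MathematicalPhysics.QuantumLattice.extEvents (U ∩ (Metric.closedBall c s)ᶜ)] φ ∧
            (fun ω : Literature.MathematicalPhysics.QuantumLattice.FieldConfig (EuclideanSpace ℝ (Fin 3)) => ω f) =ᵐ[μ] φ := by
  intro μ _ hL2 h2pt c s hs U _ f hfU
  obtain ⟨S₂, C, a, hS, ha0, ha3, hbd, h2⟩ := h2pt
  obtain ⟨fin, fout, g, hin, hout, hsum, hgf, hg0⟩ :=
    SplitAtSpheres.exists_cutoff_split c hs U f hfU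
  -- the decomposition of the evaluation
  have hdec : ∀ (n : ℕ) (ω : FieldConfig (EuclideanSpace ℝ (Fin 3))),
      ω f - (ω (fin n) + ω (fout n)) = ω (g n) := fun n ω => by
    have h := congrArg ω (hsum n)
    rw [map_add, map_add] at h
    linarith
  -- the approximants are measurable for the join
  have hψm : ∀ n : ℕ, Measurable[extEvents (U ∩ ball c s) ⊔ extEvents (U ∩ (closedBall c s)ᶜ)]
      fun ω : FieldConfig (EuclideanSpace ℝ (Fin 3)) => ω (fin n) + ω (fout n) := fun n =>
    ((measurable_eval_of_tsupport_subset (hin n)).mono le_sup_left le_rfl).add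
      ((measurable_eval_of_tsupport_subset (hout n)).mono le_sup_right le_rfl)
  have hm : extEvents (U ∩ ball c s) ⊔ extEvents (U ∩ (closedBall c s)ᶜ) ≤
      (FieldConfig.instMeasurableSpace :
        MeasurableSpace (FieldConfig (EuclideanSpace ℝ (Fin 3)))) :=
    sup_le (extEvents_le _) (extEvents_le _)
  -- the remainders vanish eventually off the (null) sphere
  have hg0' : ∀ᵐ p : EuclideanSpace ℝ (Fin 3), ∀ᶠ n in atTop, g n p = 0 := by
    have hsph : volume (sphere c s) = 0 := Measure.addHaar_sphere_of_ne_zero volume c hs.ne'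
    filter_upwards [measure_eq_zero_iff_ae_notMem.1 hsph] with p hp
    exact hg0 p fun h => hp (mem_sphere.2 h)
  have hI : Tendsto (fun n => ∫ x : Fin 2 → EuclideanSpace ℝ (Fin 3), S₂ x * (g n (x 0) * g n (x 1)))
      atTop (𝓝 0) :=
    SplitAtSpheres.tendsto_integral_twoPoint_cutoff hS ha0 ha3 hbd f g hgf hg0'
  refine SplitAtSpheres.exists_measurable_ae_eq_of_tendsto_integral_sq hm hψm
    (measurable_eval f).aestronglyMeasurable (fun n => ?_) ?_
  · have heq : (fun ω : FieldConfig (EuclideanSpace ℝ (Fin 3)) => ω f - (ω (fin n) + ω (fout n))) =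
        fun ω => ω (g n) := funext (hdec n)
    rw [heq]
    exact hL2 (g n)
  · have heq : (fun n => ∫ ω, (ω f - (ω (fin n) + ω (fout n))) ^ 2 ∂μ) =
        fun n => ∫ x : Fin 2 → EuclideanSpace ℝ (Fin 3), S₂ x * (g n (x 0) * g n (x 1)) := by
      funext n
      rw [← h2 (g n) (g n)]
      refine integral_congr_ae (Eventually.of_forall fun ω => ?_)
      dsimp only
      rw [hdec n ω, sq]
    rw [heq]
    exact hI

end Summit.CriticalPhenomena.Ising3DConformalLimit.Theorems

end
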